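import Mathlib
import Summits.ValiantsHypothesis.ValiantsHypothesis.Theorems.NewtonUnitEquationsDissociatedUniformTotalsLawModes
import HarnessLib

/-!
# Crux `NewtonUnitEquations.DissociatedUniform` (stmt-ValiantsHypothesis-5905): MONOTONE MODE LIFTS for left-turning convexly ordered curves

Companion of `…TotalsLawModes` (toolkit) and `…TotalsLawLiftCount` (`unionVert_le_of_lifts`: co-monotone lifts of the chart modes on both
charts ⇒ `#vert conv U_s(Z) ≤ 12q`).  This file DISCHARGES the lift hypothesis along one chart for an abstract chart family
`α_t = r + t·h` (`t ∈ ℝ`) of a LEFT-TURNING curve `z ↦ (r z, h z)`: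

* `higher_succ_of_mode` / `lower_pred_of_mode`: if every `α_t` is cyclically unimodal and the curve turns left at every label
  (`det(Δ_z, Δ_{z+1}) > 0`), a strict maximiser `x` of some `α_t` satisfies `h x < h (x+1)` unless `x` is a top label and
  `h (x-1) < h x` unless `x` is a bottom label (toolkit: SOME neighbour is higher/lower; left turns decide WHICH);
* `CycUnimodal.exists_min_witness`: a cyclically unimodal sequence has a witness starting at a global minimum;
* `pos_le_of_mode`, `pos_lt_pos_of_modes`: with such a witness `(n, d)` for `h`, every chart mode sits on the ascending arc
  (position `≤ d` from `n`) and the positions of the modes at times `t₁ < t₂` strictly increase;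
* **`exists_forward_lift`**: hence there are `x₀` and a MONOTONE `P : ℝ → ℕ`, `P < q`, with "strict maximiser of `α_t` = `x₀ + P t`".
The two charts of a planar curve `a` (weights `(1, t)` and `(-1, t)`) are the families `(a·0, a·1)` at time `t` and `(-a·0, -a·1)` at time
`-t` (both left-turning when `a` is); the assembly with `unionVert_le_of_lifts` is in the companion `…TotalsLawLeftTurning`.
Honest label: lemmas on a stratum; `ConvexUnionVertBound C` (`C ≥ 3`), `UnionTotalsLaw`, `TotalsLawThree` remain OPEN; nothing here bears
on VP ≠ VNP.
[folklore]
-/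

set_option linter.dupNamespace false -- `ValiantsHypothesis.ValiantsHypothesis` (summit = problem) in every name

open scoped BigOperators

namespace Summit.ValiantsHypothesis.ValiantsHypothesis.Theorems.NewtonUnitEquationsDissociatedUniform

namespace TotalsLaw

section Lifts

variable {q : ℕ} [NeZero q]

omit [NeZero q] in
/-- Two distinct labels force `1 ≠ 0` in `ℤ/q` (i.e. `q ≥ 2`). [folklore] -/
theorem one_ne_zero_of_ne {x y : ZMod q} (hxy : x ≠ y) : (1 : ZMod q) ≠ 0 := by
  intro h1
  have hq1 : q = 1 := by
    have := (ZMod.natCast_eq_zero_iff 1 q).1 (by exact_mod_cast h1)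
    exact Nat.dvd_one.1 this
  subst hq1
  exact hxy (Subsingleton.elim x y)

/-- **Left turns decide the higher neighbour.**  For a left-turning curve `z ↦ (r z, h z)` whose chart functions `r + t·h` are all
cyclically unimodal, a strict maximiser `x` of `r + t·h` with some label higher than `x` has `h x < h (x + 1)`. [folklore] -/
theorem higher_succ_of_mode (r h : ZMod q → ℝ) (hcu : ∀ t : ℝ, CycUnimodal fun z => r z + t * h z)
    (hL : ∀ z : ZMod q, 0 < (r (z + 1) - r z) * (h (z + 2) - h (z + 1)) - (h (z + 1) - h z) * (r (z + 2) - r (z + 1)))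
    {t : ℝ} {x : ZMod q} (hmode : ∀ z : ZMod q, z ≠ x → r z + t * h z < r x + t * h x) {y : ZMod q} (hy : h x < h y) :
    h x < h (x + 1) := by
  have hxy : x ≠ y := fun he => by rw [he] at hy; exact lt_irrefl _ hy
  have h10 : (1 : ZMod q) ≠ 0 := one_ne_zero_of_ne hxy
  have hx1 : x + 1 ≠ x := fun he => h10 (by simpa using he)
  have hx2 : x - 1 ≠ x := fun he => h10 (by
    have : x = x - 1 + 1 := by ring
    rw [he] at this; simpa using this.symm)
  rcases exists_higher_neighbour_of_isTop r h hcu hmode hy with hup | hdown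
  · exact hup
  · -- `h (x-1) > h x`: a non-higher successor would contradict the left turn at `x - 1`
    by_contra hcon
    push Not at hcon
    have h1 := hmode (x - 1) hx2
    have h2 := hmode (x + 1) hx1
    have h3 := hL (x - 1)
    rw [show x - 1 + 1 = x by ring, show x - 1 + 2 = x + 1 by ring] at h3
    -- `A := -(h x - h(x-1)) * (2) < 0`, `B := -(h(x+1) - h x) * (1) ≥ 0`
    have hA : 0 < -(h x - h (x - 1)) := by linarith
    have hB : 0 ≤ -(h (x + 1) - h x) := by linarith
    have A : -(h x - h (x - 1)) * (r (x + 1) + t * h (x + 1) - (r x + t * h x)) < 0 :=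
      mul_neg_of_pos_of_neg hA (by linarith)
    have B : 0 ≤ -(h (x + 1) - h x) * (r x + t * h x - (r (x - 1) + t * h (x - 1))) :=
      mul_nonneg hB (by linarith)
    nlinarith [A, B, h3]

/-- **… and the lower neighbour**: a strict maximiser `x` with some label lower than `x` has `h (x - 1) < h x`. [folklore] -/
theorem lower_pred_of_mode (r h : ZMod q → ℝ) (hcu : ∀ t : ℝ, CycUnimodal fun z => r z + t * h z)
    (hL : ∀ z : ZMod q, 0 < (r (z + 1) - r z) * (h (z + 2) - h (z + 1)) - (h (z + 1) - h z) * (r (z + 2) - r (z + 1)))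
    {t : ℝ} {x : ZMod q} (hmode : ∀ z : ZMod q, z ≠ x → r z + t * h z < r x + t * h x) {y : ZMod q} (hy : h y < h x) :
    h (x - 1) < h x := by
  have hxy : y ≠ x := fun he => by rw [he] at hy; exact lt_irrefl _ hy
  have h10 : (1 : ZMod q) ≠ 0 := one_ne_zero_of_ne hxy
  have hx1 : x + 1 ≠ x := fun he => h10 (by simpa using he)
  have hx2 : x - 1 ≠ x := fun he => h10 (by
    have : x = x - 1 + 1 := by ring
    rw [he] at this; simpa using this.symm)
  rcases exists_lower_neighbour_of_isTop r h hcu hmode hy with hup | hdown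
  · -- `h (x+1) < h x`: a non-lower predecessor would contradict the left turn at `x - 1`
    by_contra hcon
    push Not at hcon
    have h1 := hmode (x - 1) hx2
    have h2 := hmode (x + 1) hx1
    have h3 := hL (x - 1)
    rw [show x - 1 + 1 = x by ring, show x - 1 + 2 = x + 1 by ring] at h3
    have hA : 0 < -(h (x + 1) - h x) := by linarith
    have hB : 0 ≤ -(h x - h (x - 1)) := by linarith
    have A : 0 < -(h (x + 1) - h x) * (r x + t * h x - (r (x - 1) + t * h (x - 1))) :=
      mul_pos hA (by linarith)
    have B : -(h x - h (x - 1)) * (r (x + 1) + t * h (x + 1) - (r x + t * h x)) ≤ 0 :=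
      mul_nonpos_of_nonneg_of_nonpos hB (by linarith)
    nlinarith [A, B, h3]
  · exact hdown

omit [NeZero q] in
/-- **A witness starting at a global minimum.**  A cyclically unimodal sequence has a witness `(n, d)` with `h n ≤ h z` for all `z`
(if the end of the descending run is lower than the start, start one step earlier). [folklore] -/
theorem CycUnimodal.exists_min_witness [NeZero q] {h : ZMod q → ℝ} (hh : CycUnimodal h) :
    ∃ (n : ZMod q) (d : ℕ), CycUnimodalAt h n d ∧ ∀ z : ZMod q, h n ≤ h z := by
  obtain ⟨n, d, hnd⟩ := hh
  -- every value is at least `min (h n) (h (n - 1))`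
  have hlow : ∀ z : ZMod q, h n ≤ h z ∨ h (n - 1) ≤ h z := by
    intro z
    set k := (z - n).val with hk
    have hkq : k < q := ZMod.val_lt _
    have hz : z = n + (k : ZMod q) := eq_add_val n z
    rcases le_total k d with hkd | hdk
    · left
      have := hnd.asc_le (Nat.zero_le k) hkd
      rw [Nat.cast_zero, add_zero, ← hz] at this
      exact this
    · right
      have := hnd.desc_le hdk (show k ≤ q - 1 by omega) (by have := NeZero.ne q; omega)
      rw [← hz, show n + ((q - 1 : ℕ) : ZMod q) = n - 1 by
        rw [Nat.cast_sub (Nat.one_le_iff_ne_zero.2 (NeZero.ne q)), ZMod.natCast_self]; ring] at this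
      exact this
  by_cases hmin : h n ≤ h (n - 1)
  · exact ⟨n, d, hnd, fun z => (hlow z).elim id fun h' => hmin.trans h'⟩
  · push Not at hmin
    -- new witness `(n - 1, d + 1)`
    have hd1 : d + 1 < q := by
      have hd := hnd.1
      by_contra hge
      push Not at hge
      have hdq : d = q - 1 := by omega
      -- then the whole cycle ascends from `n` to `n + (q-1) = n - 1`, so `h n ≤ h (n-1)`
      have := hnd.asc_le (Nat.zero_le (q - 1)) (by omega)
      rw [Nat.cast_zero, add_zero, show n + ((q - 1 : ℕ) : ZMod q) = n - 1 by
        rw [Nat.cast_sub (Nat.one_le_iff_ne_zero.2 (NeZero.ne q)), ZMod.natCast_self]; ring] at this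
      linarith
    refine ⟨n - 1, d + 1, ⟨hd1, fun k hk => ?_, fun k hk hk1 => ?_⟩, fun z => (hlow z).elim (fun h' => hmin.le.trans h') id⟩
    · rcases Nat.eq_zero_or_pos k with rfl | hkpos
      · simp only [Nat.cast_zero, add_zero, Nat.zero_add, Nat.cast_one, sub_add_cancel]
        exact hmin.le
      · have := hnd.2.1 (k - 1) (by omega)
        rw [show n + ((k - 1 : ℕ) : ZMod q) = n - 1 + (k : ZMod q) by rw [Nat.cast_sub hkpos]; push_cast; ring,
          show n + ((k - 1 + 1 : ℕ) : ZMod q) = n - 1 + ((k + 1 : ℕ) : ZMod q) by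
            rw [show k - 1 + 1 = k by omega]; push_cast; ring] at this
        exact this
    · have := hnd.2.2 (k - 1) (by omega) (by omega)
      rw [show n + ((k - 1 + 1 : ℕ) : ZMod q) = n - 1 + ((k + 1 : ℕ) : ZMod q) by
          rw [show k - 1 + 1 = k by omega]; push_cast; ring,
        show n + ((k - 1 : ℕ) : ZMod q) = n - 1 + (k : ZMod q) by rw [Nat.cast_sub (by omega : 1 ≤ k)]; push_cast; ring] at this
      exact this

/-- **Chart modes sit on the ascending arc.**  With a min-based witness `(n, d)` for `h`, a strict maximiser `x` of some `r + t·h`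
(left-turning curve, all chart functions unimodal) has position `(x - n).val ≤ d`. [folklore] -/
theorem pos_le_of_mode (r h : ZMod q → ℝ) (hcu : ∀ t : ℝ, CycUnimodal fun z => r z + t * h z)
    (hL : ∀ z : ZMod q, 0 < (r (z + 1) - r z) * (h (z + 2) - h (z + 1)) - (h (z + 1) - h z) * (r (z + 2) - r (z + 1)))
    {n : ZMod q} {d : ℕ} (hnd : CycUnimodalAt h n d) (hmin : ∀ z, h n ≤ h z)
    {t : ℝ} {x : ZMod q} (hmode : ∀ z : ZMod q, z ≠ x → r z + t * h z < r x + t * h x) : (x - n).val ≤ d := by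
  set k := (x - n).val with hk
  have hkq : k < q := ZMod.val_lt _
  have hx : x = n + (k : ZMod q) := eq_add_val n x
  by_contra hgt
  push Not at hgt
  -- some label differs in height from `x` (else the curve could not turn left)
  have hne : ∃ y, h y ≠ h x := by
    by_contra hall
    push Not at hall
    have := hL x
    rw [hall (x + 1), hall (x + 2)] at this
    norm_num at this
  obtain ⟨y, hy⟩ := hne
  rcases lt_or_gt_of_ne hy with hlt | hgt'
  · -- a lower label exists: `h (x-1) < h x`, but the descending step `k - 1 → k` gives `h x ≤ h (x-1)`
    have hpred := lower_pred_of_mode r h hcu hL hmode hlt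
    have hstep := hnd.2.2 (k - 1) (by omega) (by omega)
    rw [show k - 1 + 1 = k by omega, ← hx,
      show n + ((k - 1 : ℕ) : ZMod q) = x - 1 by rw [hx, Nat.cast_sub (by omega : 1 ≤ k)]; push_cast; ring] at hstep
    linarith
  · -- a higher label exists: `h x < h (x+1)`; on the descending run this needs `k = q - 1`, and then `x + 1 = n` is the minimum
    have hsucc := higher_succ_of_mode r h hcu hL hmode hgt'
    rcases Nat.lt_or_ge (k + 1) q with hk1 | hk1
    · have hstep := hnd.2.2 k (by omega) hk1
      rw [← hx, show n + ((k + 1 : ℕ) : ZMod q) = x + 1 by rw [hx]; push_cast; ring] at hstep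
      linarith
    · have hkq1 : k = q - 1 := by omega
      have hx1 : x + 1 = n := by
        rw [hx, hkq1, Nat.cast_sub (by omega : 1 ≤ q), ZMod.natCast_self]; ring
      rw [hx1] at hsucc
      linarith [hmin x]

/-- **Positions of chart modes increase with time**: strict maximisers `x₁` of `r + t₁·h` and `x₂` of `r + t₂·h` with `t₁ < t₂`,
`x₁ ≠ x₂`, have positions `(x₁ - n).val < (x₂ - n).val` for a min-based witness `(n, d)` of `h`. [folklore] -/
theorem pos_lt_pos_of_modes (r h : ZMod q → ℝ) (hcu : ∀ t : ℝ, CycUnimodal fun z => r z + t * h z)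
    (hL : ∀ z : ZMod q, 0 < (r (z + 1) - r z) * (h (z + 2) - h (z + 1)) - (h (z + 1) - h z) * (r (z + 2) - r (z + 1)))
    {n : ZMod q} {d : ℕ} (hnd : CycUnimodalAt h n d) (hmin : ∀ z, h n ≤ h z) {t₁ t₂ : ℝ} (ht : t₁ < t₂) {x₁ x₂ : ZMod q}
    (hne : x₁ ≠ x₂) (hm₁ : ∀ z : ZMod q, z ≠ x₁ → r z + t₁ * h z < r x₁ + t₁ * h x₁)
    (hm₂ : ∀ z : ZMod q, z ≠ x₂ → r z + t₂ * h z < r x₂ + t₂ * h x₂) : (x₁ - n).val < (x₂ - n).val := by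
  -- heights increase along the chart
  have hh : h x₁ < h x₂ := by
    have e1 := hm₁ x₂ (Ne.symm hne)
    have e2 := hm₂ x₁ hne
    nlinarith
  have hk₁ := pos_le_of_mode r h hcu hL hnd hmin hm₁
  have hk₂ := pos_le_of_mode r h hcu hL hnd hmin hm₂
  by_contra hge
  push Not at hge
  -- on the ascending arc, position order is height order
  have := hnd.asc_le hge hk₁
  rw [← eq_add_val n x₂, ← eq_add_val n x₁] at this
  linarith

/-- **Monotone forward lift of the chart modes.**  For a left-turning curve `z ↦ (r z, h z)` all of whose chart functions `r + t·h`
are cyclically unimodal (and `h` itself is), there are a base label `x₀` and a MONOTONE `P : ℝ → ℕ` with `P < q` such that the strict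
maximiser of `r + t·h`, whenever it exists, is `x₀ + P t`. [folklore] -/
theorem exists_forward_lift (r h : ZMod q → ℝ) (hcu : ∀ t : ℝ, CycUnimodal fun z => r z + t * h z) (hh : CycUnimodal h)
    (hL : ∀ z : ZMod q, 0 < (r (z + 1) - r z) * (h (z + 2) - h (z + 1)) - (h (z + 1) - h z) * (r (z + 2) - r (z + 1))) :
    ∃ (x₀ : ZMod q) (P : ℝ → ℕ), Monotone P ∧ (∀ t, P t < q) ∧
      ∀ (t : ℝ) (x : ZMod q), (∀ z : ZMod q, z ≠ x → r z + t * h z < r x + t * h x) → x = x₀ + (P t : ZMod q) := by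
  classical
  obtain ⟨n, d, hnd, hmin⟩ := hh.exists_min_witness
  -- `P t` = the largest position of a mode seen up to time `t`
  let M : ℝ → Finset (ZMod q) := fun t =>
    Finset.univ.filter fun x => ∃ t' : ℝ, t' ≤ t ∧ ∀ z : ZMod q, z ≠ x → r z + t' * h z < r x + t' * h x
  let P : ℝ → ℕ := fun t => (M t).sup fun x => (x - n).val
  refine ⟨n, P, fun t₁ t₂ ht => ?_, fun t => ?_, fun t x hmode => ?_⟩
  · -- monotone: the filter grows
    apply Finset.sup_mono
    intro x hx
    obtain ⟨t', ht', hm⟩ := (Finset.mem_filter.1 hx).2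
    exact Finset.mem_filter.2 ⟨Finset.mem_univ _, t', ht'.trans ht, hm⟩
  · -- `P t < q`
    have hq : 0 < q := Nat.pos_of_ne_zero (NeZero.ne q)
    simp only [P]
    refine lt_of_le_of_lt (Finset.sup_le fun x _ => (Nat.le_sub_one_of_lt (ZMod.val_lt (x - n)))) (by omega)
  · -- at a mode time, `P t` is the position of the mode
    have hxM : x ∈ M t := Finset.mem_filter.2 ⟨Finset.mem_univ _, t, le_rfl, hmode⟩
    have hPx : P t = (x - n).val := by
      apply le_antisymm
      · refine Finset.sup_le fun x' hx' => ?_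
        obtain ⟨t', ht', hm'⟩ := (Finset.mem_filter.1 hx').2
        by_cases hxx : x' = x
        · rw [hxx]
        rcases lt_or_eq_of_le ht' with hlt | heq
        · exact (pos_lt_pos_of_modes r h hcu hL hnd hmin hlt hxx hm' hmode).le
        · -- two strict maximisers at the same time coincide
          exfalso
          rw [heq] at hm'
          have e1 := hm' x (Ne.symm hxx)
          have e2 := hmode x' hxx
          linarith
      · exact Finset.le_sup (f := fun x => (x - n).val) hxM
    rw [hPx]
    exact eq_add_val n x

end Lifts

end TotalsLaw

end Summit.ValiantsHypothesis.ValiantsHypothesis.Theorems.NewtonUnitEquationsDissociatedUniform
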